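import Summits.BirchSwinnertonDyer.BirchSwinnertonDyer.Theorems.ClassRecordThreeEulerHalvesAtThreeCartanCoverHeckeDatum
import HarnessLib

/-!
# Hecke operators on additive cochains (part B: T7 the Hecke datum of `X.Gamma` + period eigen-relation, T10 norm-one groups ∕ `coverHeckeDatum`, T11 overgroup ∕ eigen-transfer) — the inert-Hecke certificate for (OBS) `CartanCover.Charext.NoModThreePeriodCharacterExtension`

Support file for crux `CartanOnePlaceDegreeLawAtThree` (item stmt-BirchSwinnertonDyer-24801; lines `Lines/lattice` v6 ∕ `Lines/charext` v10, shared Galois leaf (OBS)).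
Source: `Cruxes/CartanOnePlaceDegreeLawAtThree/Lines/charext.lean` v10–v11 §InertHecke (TYPED AND PROVED by the crux ideator cruxidea-24801-1 g0, SORRY-FREE; mirror
`HOME/cruxidea-24801-1/g0/…CartanCoverHeckeDatum.lean` 7c65ea06bbc225cb); LANDED (part B; shared period lemmas `private`) by the crux LEAD tam3-p1 g27. Contents:
`HeckeDatum Γ ι` (representatives `α`, coset permutations `σ`, `mem`, `disj`; `σ_unique ∕ σ_mul ∕ σ_one ∕ σ_eq_self_of_comm`; `ofStable`; `op χ γ = Σ_i χ(α i γ α(σ γ i)⁻¹)`) with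
(T1) `op_mul`, (T2) `op_apply_of_normalised`, (T2′) `restrict ∕ op_restrict ∕ memN_of_reduction`, (T8) `changeReps ∕ op_changeReps`, (T9) `exists_changeReps_commonReduction`,
(T3) `op_apply_eq_zero_of_cube_central`, (T4) `apply_eq_zero_of_eigen`, (T5) `eigen_of_eigen_on`; (T6) `fixedPointFree_of_projective_equivariance` (+ `ne_one_of_sq_add_self_add_one_eq_zero`,
`cube_eq_one_of_sq_add_self_add_one_eq_zero`); (T7) `gammaHeckeDatum X n` + `period_op_eq_smul` (the Hecke–period identity `period_smul_eq_sum` through `op`); (T10) `unitsHeckeSet ∕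
unitsHeckeSetoid ∕ units_exists_perm_mul ∕ unitsHeckeDatum` for the norm-one group of any order and `coverHeckeDatum X q n : HeckeDatum (coverUnits X q) _`.
Uses the landed bricks `sum_eq_zero_of_three_cycles`, `no_eigenvector_of_cube_eq_one` (p737917) by name. Nothing here is specific to a curve; BSD is proved for no curve.
-/

set_option linter.dupNamespace false
set_option autoImplicit false

noncomputable section

open scoped Classical Pointwise MatrixGroups UpperHalfPlane

namespace Summit.BirchSwinnertonDyer.BirchSwinnertonDyer.Theorems.CartanCover.Charext

open Literature.NumberTheory.Automorphic

section D3Lemmas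

variable {Γ : Subgroup (GL (Fin 2) ℝ)} [Γ.HasDetOne]

/-- Elements of `Γ ≤ SL₂(ℝ)` have positive determinant.
-- adapted from Literature/NumberTheory/Automorphic/ShimuraCurvePeriodsHeckeIntegralityProofs.lean §2 (no hub olean in this closure) [folklore] -/
private theorem det_val_pos_of_mem' {γ : GL (Fin 2) ℝ} (hγ : γ ∈ Γ) : 0 < γ.det.val := by
  rw [Subgroup.HasDetOne.det_eq hγ, Units.val_one]; exact one_pos

/-- `Γ`-invariance of segment integrals: `∫_{γz}^{γw} h = ∫_z^w h`. [folklore] -/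
private theorem segmentIntegral_smul_smul' (h : CuspForm Γ 2) {γ : GL (Fin 2) ℝ} (hγ : γ ∈ Γ) (z w : ℍ) :
    segmentIntegral h (γ • z) (γ • w) = segmentIntegral h z w := by
  have e := CartanDegree.segmentIntegral_slash_inv_smul h (det_val_pos_of_mem' hγ) (γ • z) w
  rw [SlashInvariantForm.slash_action_eqn h γ hγ, inv_smul_smul] at e
  exact e.symm

/-- The period `∫_τ^{γτ} h` does not depend on the base point. [folklore] -/
private theorem period_eq_period' (h : CuspForm Γ 2) {γ : GL (Fin 2) ℝ} (hγ : γ ∈ Γ) (z w : ℍ) :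
    segmentIntegral h z (γ • z) = segmentIntegral h w (γ • w) := by
  have e1 := segmentIntegral_sub_segmentIntegral h w z (γ • z)
  have e2 := segmentIntegral_sub_segmentIntegral h w (γ • w) (γ • z)
  have e3 := segmentIntegral_smul_smul' h hγ w z
  linear_combination (-1 : ℂ) * e1 + e2 + e3

/-- Additivity of periods: `γ ↦ ∫_z^{γz} h` is a homomorphism on `Γ`. [folklore] -/
private theorem period_mul' (h : CuspForm Γ 2) {γ : GL (Fin 2) ℝ} (hγ : γ ∈ Γ) (δ : GL (Fin 2) ℝ) (z : ℍ) :
    segmentIntegral h z ((γ * δ) • z) = segmentIntegral h z (γ • z) + segmentIntegral h z (δ • z) := by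
  have e1 := segmentIntegral_sub_segmentIntegral h z (δ • z) ((γ * δ) • z)
  have e2 : segmentIntegral h (δ • z) ((γ * δ) • z) = segmentIntegral h z (γ • z) := by
    rw [mul_smul]; exact (period_eq_period' h hγ z (δ • z)).symm
  linear_combination e1 + e2

end D3Lemmas

namespace InertHecke

/-! #### (T7) the Hecke datum of `Γ = X.Gamma` on `Γ∖ι(O(n))` and the period eigen-relation — PROVED (v9.4) -/

section T7

variable {D M : ℕ} {C : Finset ℕ} (X : CartanLevelCurveData D M C)

/-- **the Hecke datum of `Γ` on `Γ∖ι(O(n))`** (representatives `q.out`; stability = the LEAD's `CartanCover.HeckePeriod.exists_perm_mul`). [folklore] -/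
noncomputable def gammaHeckeDatum (n : ℕ) [Fintype (Quotient (X.heckeSetoid n))] :
    HeckeDatum X.Gamma (Quotient (X.heckeSetoid n)) :=
  HeckeDatum.ofStable (fun q => ((q.out : X.heckeSet n) : GL (Fin 2) ℝ))
    (by
      intro q q' g hg h
      have hr : (X.heckeSetoid n) q'.out q.out := ⟨g, hg, h.symm⟩
      have := Quotient.sound hr
      rw [Quotient.out_eq, Quotient.out_eq] at this
      exact this.symm)
    (by
      intro γ q
      obtain ⟨e, δ, hδ, hδeq⟩ := CartanCover.HeckePeriod.exists_perm_mul X n γ.2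
      refine ⟨e q, ?_⟩
      have h := hδeq q
      have : ((q.out : X.heckeSet n) : GL (Fin 2) ℝ) * γ * (((e q).out : X.heckeSet n) : GL (Fin 2) ℝ)⁻¹ = δ q := by
        rw [h, mul_inv_cancel_right]
      rw [this]; exact hδ q)

/-- the representatives of `gammaHeckeDatum` are the `q.out`. [folklore] -/
theorem gammaHeckeDatum_α (n : ℕ) [Fintype (Quotient (X.heckeSetoid n))] (q : Quotient (X.heckeSetoid n)) :
    (gammaHeckeDatum X n).α q = ((q.out : X.heckeSet n) : GL (Fin 2) ℝ) := by
  rw [gammaHeckeDatum, HeckeDatum.ofStable_α]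

/-- **(T7) periods of a `T_n`-eigenform are a Hecke eigen-cochain**: if `T_n F = a·F`, the period cochain `γ ↦ ∫_z^{γ z} F` on `Γ` satisfies `T(per) = a · per` for the
Hecke datum `gammaHeckeDatum X n` — the LEAD's Hecke–period identity `period_smul_eq_sum` read through `HeckeDatum.op`. [cite: ShimuraIATAF1971, §8.3 (8.3.2)] -/
theorem period_op_eq_smul (n : ℕ) [Fintype (Quotient (X.heckeSetoid n))] (F : CuspForm X.Gamma 2) (a : ℂ)
    (hF : X.heckeFun n F = fun τ => a * F τ) (z : ℍ) (γ : X.Gamma) :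
    (gammaHeckeDatum X n).op (fun δ : X.Gamma => segmentIntegral F z ((δ : GL (Fin 2) ℝ) • z)) γ
      = a * segmentIntegral F z ((γ : GL (Fin 2) ℝ) • z) := by
  set H := gammaHeckeDatum X n with hH
  rw [HeckeDatum.op_apply]
  have hα : ∀ q, H.α q = ((q.out : X.heckeSet n) : GL (Fin 2) ℝ) := gammaHeckeDatum_α X n
  have key := CartanCover.HeckePeriod.period_smul_eq_sum X n F a hF (γ := (γ : GL (Fin 2) ℝ)) (H.σ γ)
    (fun q => H.α q * γ * (H.α (H.σ γ q))⁻¹) (fun q => H.mem γ q)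
    (fun q => by rw [← hα q, ← hα (H.σ γ q), inv_mul_cancel_right]) z
  rw [key]

end T7


/-! #### (T10) the Hecke datum of the norm-one group `ι(O¹)` of ANY order on `ι(O¹)∖ι(O(n))` — in particular of `ι(O₀'¹) = coverUnits X q` — PROVED (v9.7) -/

section UnitsHecke

variable {B : Type*} [Ring B] [Algebra ℚ B] (ιB : B →ₐ[ℚ] Matrix (Fin 2) (Fin 2) ℝ) {O : Submodule ℤ B} (hO : Brandt.IsOrder B O)

/-- `ι(O(n))`: the invertible real matrices `ι(x)`, `x ∈ O`, of determinant `n` (as `CartanLevelCurveData.heckeSet`, for an arbitrary order). [folklore] -/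
def unitsHeckeSet (n : ℕ) : Set (GL (Fin 2) ℝ) :=
  {g | (∃ x ∈ O, ιB x = (g : Matrix (Fin 2) (Fin 2) ℝ)) ∧ (g : Matrix (Fin 2) (Fin 2) ℝ).det = n}

/-- left `ι(O¹)`-cosets on `ι(O(n))`. [folklore] -/
def unitsHeckeSetoid (n : ℕ) : Setoid (unitsHeckeSet ιB (O := O) n) where
  r a a' := ∃ γ ∈ normOneUnits ιB hO, γ * (a : GL (Fin 2) ℝ) = a'
  iseqv :=
    { refl := fun a => ⟨1, one_mem _, one_mul _⟩
      symm := fun {a a'} ⟨γ, hγ, h⟩ => ⟨γ⁻¹, inv_mem hγ, by rw [← h, inv_mul_cancel_left]⟩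
      trans := fun {a a' a''} ⟨γ, hγ, h⟩ ⟨γ', hγ', h'⟩ =>
        ⟨γ' * γ, mul_mem hγ' hγ, by rw [mul_assoc, h, h']⟩ }

/-- `ι(O(n)) · ι(O¹) ⊆ ι(O(n))`. [folklore] -/
theorem unitsHeckeSet_mul_mem {n : ℕ} {a γ : GL (Fin 2) ℝ} (ha : a ∈ unitsHeckeSet ιB (O := O) n) (hγ : γ ∈ normOneUnits ιB hO) :
    a * γ ∈ unitsHeckeSet ιB (O := O) n := by
  obtain ⟨⟨x, hx, hxa⟩, hdet⟩ := ha
  obtain ⟨⟨y, hy, hyγ⟩, -, hγ1⟩ := hγ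
  refine ⟨⟨x * y, hO.mul_mem x hx y hy, by rw [map_mul, hxa, hyγ, Units.val_mul]⟩, ?_⟩
  rw [Units.val_mul, Matrix.det_mul, hdet, ← Matrix.GeneralLinearGroup.val_det_apply, hγ1, Units.val_one, mul_one]

/-- **right multiplication by `γ ∈ ι(O¹)` permutes `ι(O¹)∖ι(O(n))`** (the LEAD's `CartanCover.HeckePeriod.exists_perm_mul`, for an arbitrary order). [cite: ShimuraIATAF1971, §3.3] -/
theorem units_exists_perm_mul (n : ℕ) {γ : GL (Fin 2) ℝ} (hγ : γ ∈ normOneUnits ιB hO) :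
    ∃ (e : Quotient (unitsHeckeSetoid ιB hO n) ≃ Quotient (unitsHeckeSetoid ιB hO n))
      (δ : Quotient (unitsHeckeSetoid ιB hO n) → GL (Fin 2) ℝ),
      (∀ q, δ q ∈ normOneUnits ιB hO) ∧
      ∀ q, ((q.out : unitsHeckeSet ιB (O := O) n) : GL (Fin 2) ℝ) * γ
        = δ q * (((e q).out : unitsHeckeSet ιB (O := O) n) : GL (Fin 2) ℝ) := by
  let S := unitsHeckeSet ιB (O := O) n
  let ρ : S → S := fun a => ⟨a * γ, unitsHeckeSet_mul_mem ιB hO a.2 hγ⟩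
  let ρ' : S → S := fun a => ⟨a * γ⁻¹, unitsHeckeSet_mul_mem ιB hO a.2 (inv_mem hγ)⟩
  have hρ : ∀ a b : S, (unitsHeckeSetoid ιB hO n) a b → (unitsHeckeSetoid ιB hO n) (ρ a) (ρ b) := by
    rintro a b ⟨δ, hδ, hab⟩
    exact ⟨δ, hδ, by simp only [ρ, ← mul_assoc, hab]⟩
  have hρ' : ∀ a b : S, (unitsHeckeSetoid ιB hO n) a b → (unitsHeckeSetoid ιB hO n) (ρ' a) (ρ' b) := by
    rintro a b ⟨δ, hδ, hab⟩
    exact ⟨δ, hδ, by simp only [ρ', ← mul_assoc, hab]⟩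
  let e : Quotient (unitsHeckeSetoid ιB hO n) ≃ Quotient (unitsHeckeSetoid ιB hO n) :=
    { toFun := Quotient.map ρ hρ
      invFun := Quotient.map ρ' hρ'
      left_inv := fun q => Quotient.inductionOn q fun a => by
        simp only [Quotient.map_mk]
        refine congrArg _ (Subtype.ext ?_)
        simp only [ρ, ρ', mul_inv_cancel_right]
      right_inv := fun q => Quotient.inductionOn q fun a => by
        simp only [Quotient.map_mk]
        refine congrArg _ (Subtype.ext ?_)
        simp only [ρ, ρ', inv_mul_cancel_right] }
  have hδex : ∀ q : Quotient (unitsHeckeSetoid ιB hO n), ∃ δ ∈ normOneUnits ιB hO,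
      ((q.out : S) : GL (Fin 2) ℝ) * γ = δ * (((e q).out : S) : GL (Fin 2) ℝ) := by
    intro q
    have h1 : e q = Quotient.mk _ (ρ q.out) := by
      change Quotient.map ρ hρ q = _
      conv_lhs => rw [← Quotient.out_eq q]
      rfl
    have h2 : (unitsHeckeSetoid ιB hO n) (e q).out (ρ q.out) := Quotient.exact (((e q).out_eq).trans h1)
    obtain ⟨δ, hδ, hδeq⟩ := h2
    refine ⟨δ, hδ, ?_⟩
    have hδeq' : δ * (((e q).out : S) : GL (Fin 2) ℝ) = ((q.out : S) : GL (Fin 2) ℝ) * γ := hδeq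
    exact hδeq'.symm
  choose δ hδ hδeq using hδex
  exact ⟨e, δ, hδ, hδeq⟩

/-- **(T10) the Hecke datum of `ι(O¹)` on `ι(O¹)∖ι(O(n))`** for an arbitrary order `O` (representatives `q.out`), given finiteness of the coset space. [folklore] -/
noncomputable def unitsHeckeDatum (n : ℕ) [Finite (Quotient (unitsHeckeSetoid ιB hO n))] :
    HeckeDatum (normOneUnits ιB hO) (Quotient (unitsHeckeSetoid ιB hO n)) :=
  HeckeDatum.ofStable (fun q => ((q.out : unitsHeckeSet ιB (O := O) n) : GL (Fin 2) ℝ))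
    (by
      intro q q' g hg h
      have hr : (unitsHeckeSetoid ιB hO n) q'.out q.out := ⟨g, hg, h.symm⟩
      have := Quotient.sound hr
      rw [Quotient.out_eq, Quotient.out_eq] at this
      exact this.symm)
    (by
      intro γ q
      obtain ⟨e, δ, hδ, hδeq⟩ := units_exists_perm_mul ιB hO n γ.2
      refine ⟨e q, ?_⟩
      have : ((q.out : unitsHeckeSet ιB (O := O) n) : GL (Fin 2) ℝ) * γ * (((e q).out : unitsHeckeSet ιB (O := O) n) : GL (Fin 2) ℝ)⁻¹ = δ q := by
        rw [hδeq q, mul_inv_cancel_right]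
      rw [this]; exact hδ q)

end UnitsHecke

/-- **the Hecke datum of `ι(O₀'¹) = coverUnits X q` on `ι(O₀'¹)∖ι(O₀'(n))`** — THE object of the inert-Hecke certificate for (OBS) (apply with `n = ℓ` prime, `ℓ ∤ 3 q N`; then
change representatives to a common reduction mod `q` by (T9) + (M0), restrict to `Γ̄(q)` by (T2′)). [folklore] -/
noncomputable def coverHeckeDatum {D M : ℕ} {C : Finset ℕ} (X : CartanLevelCurveData D M C) (q n : ℕ)
    [Finite (Quotient (unitsHeckeSetoid X.ι (CartanCover.isOrder_coverOrder X q) n))] :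
    HeckeDatum (CartanCover.coverUnits X q) (Quotient (unitsHeckeSetoid X.ι (CartanCover.isOrder_coverOrder X q) n)) :=
  unitsHeckeDatum X.ι (CartanCover.isOrder_coverOrder X q) n


/-! ### (T11) ONE FAMILY OF REPRESENTATIVES FOR THE THREE GROUPS `Γ̄(q) ≤ Γ ≤ ι(O₀'¹)`

The inert-Hecke certificate compares THREE Hecke operators at a prime `ℓ ∤ 3qN`: on `Γ = ι(O¹)` (where `per_F` is eigen, (T7)), on the cover group
`U = ι(O₀'¹) = coverUnits X q` (where `χ̄` lives) and on `N = Γ̄(q) = principalLevel X q` (where `χ̄ = c·per_F`). They are compatible as soon as ONE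
family of representatives `α_i ∈ ι(O(ℓ))` serves all three: `U`-inequivalent and `U`-stable (then `ofStable` gives the `U`-datum, whose permutations and
operator agree with the `Γ`-datum on `Γ`, (T11a)), and mapping `N` to `N` (then the eigen-relation transfers from `Γ` to `U` along `N`, (T11b)). The
existence of such a family — `Γ`-translates `g_i · q_i.out` of the tree's representatives with a COMMON reduction mod `q` — is the print input (SIMREP)
below (strong approximation, (M0), and the local structure at `ℓ`). -/

section Overgroup

namespace HeckeDatum

variable {𝔾 : Type*} [Group 𝔾] {Γ : Subgroup 𝔾} {ι : Type*} [Fintype ι] (H : HeckeDatum Γ ι)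

/-- **(T11a) overgroup on the same representatives — permutations agree on `Γ`.** [folklore] -/
theorem σ_ofStable_overgroup (U : Subgroup 𝔾) (hΓU : Γ ≤ U)
    (disjU : ∀ (i j : ι) (g : 𝔾), g ∈ U → H.α i = g * H.α j → i = j)
    (stabU : ∀ (u : U) (i : ι), ∃ j, H.α i * u * (H.α j)⁻¹ ∈ U) (γ : Γ) (i : ι) :
    (ofStable (Γ := U) H.α disjU stabU).σ ⟨γ, hΓU γ.2⟩ i = H.σ γ i := by
  symm
  apply (ofStable (Γ := U) H.α disjU stabU).σ_unique ⟨γ, hΓU γ.2⟩ i (H.σ γ i)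
  simp only [ofStable_α]
  exact hΓU (H.mem γ i)

/-- **(T11a) overgroup on the same representatives — the operator restricted to `Γ` is the `Γ`-operator of the restricted cochain**:
`(T_U χ)(γ) = (T_Γ (χ|Γ))(γ)` for `γ ∈ Γ`. [folklore] -/
theorem op_ofStable_overgroup {A : Type*} [AddCommGroup A] (U : Subgroup 𝔾) (hΓU : Γ ≤ U)
    (disjU : ∀ (i j : ι) (g : 𝔾), g ∈ U → H.α i = g * H.α j → i = j)
    (stabU : ∀ (u : U) (i : ι), ∃ j, H.α i * u * (H.α j)⁻¹ ∈ U) (χ : U → A) (γ : Γ) :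
    (ofStable (Γ := U) H.α disjU stabU).op χ ⟨γ, hΓU γ.2⟩ = H.op (fun δ : Γ => χ ⟨δ, hΓU δ.2⟩) γ := by
  rw [op_apply, op_apply]
  refine Finset.sum_congr rfl fun i _ => ?_
  have e : (⟨(ofStable (Γ := U) H.α disjU stabU).α i * ((⟨(γ : 𝔾), hΓU γ.2⟩ : U) : 𝔾)
        * ((ofStable (Γ := U) H.α disjU stabU).α ((ofStable (Γ := U) H.α disjU stabU).σ ⟨γ, hΓU γ.2⟩ i))⁻¹,
        (ofStable (Γ := U) H.α disjU stabU).mem ⟨γ, hΓU γ.2⟩ i⟩ : U)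
      = ⟨H.α i * γ * (H.α (H.σ γ i))⁻¹, hΓU (H.mem γ i)⟩ := by
    apply Subtype.ext
    simp only [ofStable_α, H.σ_ofStable_overgroup U hΓU disjU stabU γ i]
  rw [e]

/-- **(T11b) EIGEN-TRANSFER ALONG A SUBGROUP SERVED BY THE SAME REPRESENTATIVES.** `N ≤ Γ ≤ U`; the representatives of `H` send `N` to `N`
(`memN`); `χ : U → A` agrees on `N` with `ψ : Γ → A`; and `ψ` satisfies `(T_Γ ψ)(β) = f(ψ(β))` at the elements of `N` (`f` = multiplication by the
eigenvalue). Then `(T_U χ)(β) = f(χ(β))` for every `β ∈ N`. In the certificate: `U = ι(O₀'¹)`, `Γ = ι(O¹)`, `N = Γ̄(q)`, `ψ = c·per_F` (eigen by (T7)+(T8)),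
`χ` the extension of (OBS); with RES-INJ ((T5), `modThree_trivial_of_trivial_on_principalLevel`) the relation then holds on all of `U`. [folklore] -/
theorem op_ofStable_overgroup_eq_on {A : Type*} [AddCommGroup A] (U : Subgroup 𝔾) (hΓU : Γ ≤ U)
    (disjU : ∀ (i j : ι) (g : 𝔾), g ∈ U → H.α i = g * H.α j → i = j)
    (stabU : ∀ (u : U) (i : ι), ∃ j, H.α i * u * (H.α j)⁻¹ ∈ U)
    (N : Subgroup 𝔾) (hNΓ : N ≤ Γ)
    (memN : ∀ (β : 𝔾) (hβ : β ∈ N) (i : ι), H.α i * β * (H.α (H.σ ⟨β, hNΓ hβ⟩ i))⁻¹ ∈ N)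
    (χ : U → A) (ψ : Γ → A) (hagree : ∀ (n : 𝔾) (hn : n ∈ N), χ ⟨n, hΓU (hNΓ hn)⟩ = ψ ⟨n, hNΓ hn⟩)
    (f : A → A) (heig : ∀ (β : 𝔾) (hβ : β ∈ N), H.op ψ ⟨β, hNΓ hβ⟩ = f (ψ ⟨β, hNΓ hβ⟩))
    (β : 𝔾) (hβ : β ∈ N) :
    (ofStable (Γ := U) H.α disjU stabU).op χ ⟨β, hΓU (hNΓ hβ)⟩ = f (χ ⟨β, hΓU (hNΓ hβ)⟩) := by
  have e1 := H.op_ofStable_overgroup U hΓU disjU stabU χ ⟨β, hNΓ hβ⟩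
  have e2 : (⟨β, hΓU (hNΓ hβ)⟩ : U) = ⟨((⟨β, hNΓ hβ⟩ : Γ) : 𝔾), hΓU (⟨β, hNΓ hβ⟩ : Γ).2⟩ := rfl
  rw [e2, e1, hagree β hβ, ← heig β hβ, op_apply, op_apply]
  refine Finset.sum_congr rfl fun i _ => ?_
  exact hagree _ (memN β hβ i)

omit [Fintype ι] in
/-- **(T11b′) the `memN` criterion from a two-sided test**: if every `α_i β α_j⁻¹` (`β ∈ N`) that lies in `Γ` already lies in `N`, the representatives
serve `N`. (With a reduction map: all `α_i` have a common reduction mod `q` and `N = ker`, (T2′) `memN_of_reduction`.) [folklore] -/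
theorem memN_of_criterion (N : Subgroup 𝔾) (hNΓ : N ≤ Γ)
    (crit : ∀ (β : 𝔾), β ∈ N → ∀ (i j : ι), H.α i * β * (H.α j)⁻¹ ∈ Γ → H.α i * β * (H.α j)⁻¹ ∈ N)
    (β : 𝔾) (hβ : β ∈ N) (i : ι) : H.α i * β * (H.α (H.σ ⟨β, hNΓ hβ⟩ i))⁻¹ ∈ N :=
  crit β hβ i _ (H.mem ⟨β, hNΓ hβ⟩ i)

end HeckeDatum

end Overgroup

section T11c

variable {D M : ℕ} {C : Finset ℕ} (X : CartanLevelCurveData D M C)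

/-- **(T11c) the period cochain stays eigen after a change of representatives** (`(T7)` + `(T8)` + additivity of periods `period_mul'`). [cite: ShimuraIATAF1971, §8.3 (8.3.2)] -/
theorem period_op_changeReps_eq_smul (n : ℕ) [Fintype (Quotient (X.heckeSetoid n))] (F : CuspForm X.Gamma 2) (a : ℂ)
    (hF : X.heckeFun n F = fun τ => a * F τ) (z : ℍ) (g : Quotient (X.heckeSetoid n) → X.Gamma) (γ : X.Gamma) :
    ((gammaHeckeDatum X n).changeReps g).op (fun δ : X.Gamma => segmentIntegral F z ((δ : GL (Fin 2) ℝ) • z)) γ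
      = a * segmentIntegral F z ((γ : GL (Fin 2) ℝ) • z) := by
  rw [HeckeDatum.op_changeReps _ g _ (fun δ₁ δ₂ => by
    simpa only [Subgroup.coe_mul] using period_mul' F δ₁.2 (δ₂ : GL (Fin 2) ℝ) z)]
  exact period_op_eq_smul X n F a hF z γ

/-- **(T11d) THE COVER-LEVEL EIGEN-RELATION ON `Γ̄(q)`** — (T11a–c) assembled for `U = coverUnits X q`, `Γ = X.Gamma`, `N = principalLevel X q`: if the changed
representatives `g_i · q_i.out` are `U`-inequivalent, `U`-stable and pass the two-sided test for `Γ̄(q)`, then for ANY cochain `χ` on `U` agreeing on `Γ̄(q)` with a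
cochain `ψ` on `Γ` that is eigen for the changed `Γ`-datum (e.g. `ψ = c·per_F` pushed to `Λ∕3Λ`, by (T11c)), the `U`-operator satisfies the same relation on `Γ̄(q)`. [folklore] -/
theorem cover_op_eq_on_principalLevel {q : ℕ} (hq : q ∈ C) (n : ℕ) [Fintype (Quotient (X.heckeSetoid n))]
    (g : Quotient (X.heckeSetoid n) → X.Gamma)
    (disjU : ∀ (i j : Quotient (X.heckeSetoid n)) (u : GL (Fin 2) ℝ), u ∈ CartanCover.coverUnits X q →
      ((gammaHeckeDatum X n).changeReps g).α i = u * ((gammaHeckeDatum X n).changeReps g).α j → i = j)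
    (stabU : ∀ (u : CartanCover.coverUnits X q) (i : Quotient (X.heckeSetoid n)), ∃ j,
      ((gammaHeckeDatum X n).changeReps g).α i * u * (((gammaHeckeDatum X n).changeReps g).α j)⁻¹ ∈ CartanCover.coverUnits X q)
    (crit : ∀ (β : GL (Fin 2) ℝ), β ∈ CartanCover.principalLevel X q → ∀ (i j : Quotient (X.heckeSetoid n)),
      ((gammaHeckeDatum X n).changeReps g).α i * β * (((gammaHeckeDatum X n).changeReps g).α j)⁻¹ ∈ X.Gamma →
      ((gammaHeckeDatum X n).changeReps g).α i * β * (((gammaHeckeDatum X n).changeReps g).α j)⁻¹ ∈ CartanCover.principalLevel X q)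
    {A : Type*} [AddCommGroup A] (χ : CartanCover.coverUnits X q → A) (ψ : X.Gamma → A)
    (hagree : ∀ (β : GL (Fin 2) ℝ) (hβ : β ∈ CartanCover.principalLevel X q),
      χ ⟨β, CartanCover.principalLevel_le_coverUnits X q hβ⟩ = ψ ⟨β, CartanCover.principalLevel_le_Gamma X q hq hβ⟩)
    (f : A → A) (heig : ∀ γ : X.Gamma, ((gammaHeckeDatum X n).changeReps g).op ψ γ = f (ψ γ))
    (β : GL (Fin 2) ℝ) (hβ : β ∈ CartanCover.principalLevel X q) :
    (HeckeDatum.ofStable (Γ := CartanCover.coverUnits X q) ((gammaHeckeDatum X n).changeReps g).α disjU stabU).op χ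
        ⟨β, CartanCover.principalLevel_le_coverUnits X q hβ⟩
      = f (χ ⟨β, CartanCover.principalLevel_le_coverUnits X q hβ⟩) :=
  ((gammaHeckeDatum X n).changeReps g).op_ofStable_overgroup_eq_on (CartanCover.coverUnits X q) (CartanCover.Gamma_le_coverUnits X q)
    disjU stabU (CartanCover.principalLevel X q) (CartanCover.principalLevel_le_Gamma X q hq)
    (((gammaHeckeDatum X n).changeReps g).memN_of_criterion _ _ crit) χ ψ hagree f (fun b _hb => heig ⟨b, _⟩) β hβ

/-- **(SIMREP) SIMULTANEOUS HECKE REPRESENTATIVES AT A GOOD PRIME** [PRINT INPUT of the certificate]: for `q ∈ C` and a prime `ℓ ∤ q·D·M·∏_C p`, some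
`Γ`-translates `α_i = g_i · q_i.out` (`g_i ∈ Γ = ι(O¹)`) of the tree's representatives of `Γ∖ι(O(ℓ))` are (i) pairwise `ι(O₀'¹)`-inequivalent, (ii) right-`ι(O₀'¹)`-stable,
(iii) pass the two-sided test for `Γ̄(q)` (every `α_i β α_j⁻¹ ∈ Γ`, `β ∈ Γ̄(q)`, lies in `Γ̄(q)` — all `α_i` have ONE reduction mod `q`, arranged by (M0) since `red(Γ)` is the
norm-one torus and two elements of `𝔽_{q²}^×` of norm `ℓ` differ by a norm-one element), and (iv) represent every `ι(O₀'¹)`-coset of `ι(O₀'(ℓ))` (so the `ofStable` datum IS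
`T_ℓ` of the cover). (i)∕(iv): both coset spaces are `ℙ¹(𝔽_ℓ)` via the local component at `ℓ`, where `O_ℓ = O₀'_ℓ` is maximal (class number one ∕ strong approximation).
Why it might fail: it should not for `ℓ ∤ q·level`; at `ℓ | n_q` the cover order is not maximal at `ℓ` and (i)∕(iv) break. [cite: ShimuraIATAF1971, Prop. 3.36 and §3.3]
[cite: Voight2021, Thm. 28.5.3] [cite: Miyake2006, §5.3] -/
@[conjecture]
def SimultaneousHeckeReps : Prop :=
  ∀ (D M : ℕ) (C : Finset ℕ) (X : CartanLevelCurveData D M C) (q : ℕ) [Fact q.Prime], q ∈ C →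
    ∀ (ℓ : ℕ), ℓ.Prime → ¬ ℓ ∣ q * (D * M * ∏ p ∈ C, p) →
      ∃ g : Quotient (X.heckeSetoid ℓ) → GL (Fin 2) ℝ,
        (∀ i, g i ∈ X.Gamma) ∧
        (∀ (i j : Quotient (X.heckeSetoid ℓ)) (u : GL (Fin 2) ℝ), u ∈ CartanCover.coverUnits X q →
          g i * ((i.out : X.heckeSet ℓ) : GL (Fin 2) ℝ) = u * (g j * ((j.out : X.heckeSet ℓ) : GL (Fin 2) ℝ)) → i = j) ∧
        (∀ u ∈ CartanCover.coverUnits X q, ∀ (i : Quotient (X.heckeSetoid ℓ)), ∃ j : Quotient (X.heckeSetoid ℓ),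
          g i * ((i.out : X.heckeSet ℓ) : GL (Fin 2) ℝ) * u * (g j * ((j.out : X.heckeSet ℓ) : GL (Fin 2) ℝ))⁻¹ ∈ CartanCover.coverUnits X q) ∧
        (∀ β ∈ CartanCover.principalLevel X q, ∀ (i j : Quotient (X.heckeSetoid ℓ)),
          g i * ((i.out : X.heckeSet ℓ) : GL (Fin 2) ℝ) * β * (g j * ((j.out : X.heckeSet ℓ) : GL (Fin 2) ℝ))⁻¹ ∈ X.Gamma →
          g i * ((i.out : X.heckeSet ℓ) : GL (Fin 2) ℝ) * β * (g j * ((j.out : X.heckeSet ℓ) : GL (Fin 2) ℝ))⁻¹ ∈ CartanCover.principalLevel X q) ∧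
        (∀ a ∈ unitsHeckeSet X.ι (O := CartanCover.coverOrder X q) ℓ, ∃ (i : Quotient (X.heckeSetoid ℓ)),
          ∃ u ∈ CartanCover.coverUnits X q, u * a = g i * ((i.out : X.heckeSet ℓ) : GL (Fin 2) ℝ))

end T11c


end InertHecke

end Summit.BirchSwinnertonDyer.BirchSwinnertonDyer.Theorems.CartanCover.Charext

end
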